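import Literature.AlgebraicGeometry.GroupSchemes.ImageIdealRecognitionByRank     -- ★ (D6-rk): `finrank_quotient_ker_comap_mul_finrank_alg_ker`, `eq_ker_comap_of_le_of_finrank_quotient_mul_finrank_alg_ker_eq`, `isHopfIdeal_ker_comap`
import Literature.AlgebraicGeometry.GroupSchemes.HopfIdealClosedSubgroup         -- ★ `quotIncl`, `mono_quotIncl`
import Literature.AlgebraicGeometry.GroupSchemes.AffineGroupSchemeSpecPoints     -- ★ `algSpecOverEquiv : Γ(Spec H) ≃ₐ H`
import Literature.AlgebraicGeometry.GroupSchemes.BTGroupUniformizerKernelRank    -- ★ `Alg.finrank_eq_of_iso`, `exists_iso_of_fac_of_fac`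
import HarnessLib

/-!
# The image ideal of a layer map whose kernel is cut out by an ideal: corank, uniqueness below the kernel, admissibility
# ([Milne2017] Ch. 3 §b Prop. 3.11, 3.15; Ch. 11 §b Prop. 11.10; [Tate1997FiniteFlatGroupSchemes] (3.7); [GortzWedhorn2020] Def. 4.45 (2))

Topic `Literature/AlgebraicGeometry/GroupSchemes`; namespace `Literature.AlgebraicGeometry.GroupSchemes.AffineGroupScheme` (continues ★ (D6-rk)
`ImageIdealRecognitionByRank`).  THEOREMS ONLY (no definition, no instance, no notation, no named fact, no `sorry`).  Cell `hodgecm-mathlib` (D-0151),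
programme P6 «MOD» (crux hLiu418 = stmt-HodgeConjecture-24832, `--supports`, count-neutral): line L2 of the D-line socket `stub_DOWN`, organ `stub_SPGEOM`,
piece **(ρ3a) «THE IMAGE LINE DOWNSTAIRS IS UNIQUE AND ADMISSIBLE»** (LA2-plan (g0) ruling «ρ-ROAD v2.1» 2026-09-02T06:01Z (iii); payer LA6-p03 (g2)): the D6
kills-form law `QuotQuot₀Law` hands an admissible ideal `H′ ≤ ker Γ(φ)` for the `c•w`-layer map `φ : G₀(x̄) → G₀(x̄′)` of a reduced Hecke roof, where the
roof's reduced hom `ψ̄` KILLS EXACTLY the closed subgroup `V(H) ↪ G₀(x̄)` of an admissible ideal `H` of corank `q` ((ρ1) `exists_redHom_spGeoOf`: the clause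
«`t ≫ ι₀G ≫ ψ̄ = 1 ↔ t` factors through `quotIncl G₀ H`»).  This file turns that EXACTNESS clause plus the rank count `dim Γ(G₀) = q·q` into: the image ideal
`ker Γ(φ)` has corank `q`, every ideal of corank `q` below it IS it, and it is Hopf and stable under any endomorphism family intertwined by `φ` — i.e. it is the
UNIQUE admissible ideal below the kernel («the image line»).  Generic over a field; no docks, no lines.  HC_CM is proved only modulo the printed citations until
rung 0 closes; this file is generic and changes no count.

THE MATHEMATICS.  `φ : G₁ → G₂` a homomorphism of finite (affine) group schemes over a field `k`, `H ⊂ Γ(G₁)` an ideal with `V(H) = Spec (Γ(G₁) ⧸ H) ↪ G₁`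
(★ `quotIncl`) having the SAME `T`-points as `Ker φ` for every `k`-scheme `T`.  Then `Ker φ ≅ V(H)` over `G₁` (two monomorphisms with mutual factorisations,
[GortzWedhorn2020] Def. 4.45 (2)), so `dim_k Γ(Ker φ) = dim_k (Γ(G₁) ⧸ H)`; by [Milne2017] Prop. 11.10 («`o(G) = o(Ker) · o(Im)`», ★ (D6-rk)
`finrank_quotient_ker_comap_mul_finrank_alg_ker`) the image `V(ker Γ(φ))` has order `dim_k Γ(G₁) ⁄ dim_k (Γ(G₁) ⧸ H)`; an ideal `I ≤ ker Γ(φ)` of that corank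
equals `ker Γ(φ)` (★ (D6-rk) head); `ker Γ(φ)` is a Hopf ideal ([Milne2017] Prop. 3.11, ★ `isHopfIdeal_ker_comap`) and `Γ(β₂ a)(ker Γ(φ)) ⊆ ker Γ(φ)` whenever
`β₁ a ≫ φ = φ ≫ β₂ a` (functoriality of `Γ`).  When `φ` lies OVER a hom `ψ : A₁ → A₂` of ambient group schemes along monomorphic homs `ιᵢ : Gᵢ ↪ Aᵢ`
(`φ ≫ ι₂ = ι₁ ≫ ψ`), the `T`-points of `Ker φ` are the `T`-points `t` of `G₁` with `t ≫ ι₁ ≫ ψ = 1` (cancel the mono `ι₂`), which is the shape in which (ρ1)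
states exactness.

* §1 `comp_eq_one_iff_comp_comp_eq_one_of_mono` (kernel points through an ambient mono), `forall_comp_eq_one_iff_of_over` (the (ρ1) clause ⇒ the kernel clause);
* §2 `exists_iso_ker_specOver_quotient` (`Ker φ ≅ V(H)` over `G₁`), `finrank_alg_ker_eq_finrank_quotient` (`dim Γ(Ker φ) = dim (Γ(G₁) ⧸ H)`);
* §3 **`finrank_quotient_ker_appTop_eq_of_kernel_ideal`** (corank of the image ideal `= n` when `dim Γ(G₁) = n · m`, `dim (Γ(G₁) ⧸ H) = m`),
  **`eq_ker_appTop_of_le_of_kernel_ideal`** (UNIQUENESS below the kernel), `map_appTop_ker_appTop_le_of_comm` (STABILITY),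
  **`isHopfIdeal_and_finrank_and_map_le_ker_appTop`** (the admissible triple of ★ (UP-ADM) ∕ `IsAdm` unfolded), and the D6-letter form
  **`eq_ker_appTop_of_admissible_of_le`** ∕ **`existsUnique_admissible_le_ker_appTop`** (over an ambient `ψ`: `…_of_over`).

## References
* [Milne2017] J. S. Milne, *Algebraic Groups* (2017), Ch. 3 §b Prop. 3.11, Prop. 3.15; Ch. 11 §b Prop. 11.10.
* [Tate1997FiniteFlatGroupSchemes] J. Tate, *Finite flat group schemes* (1997), (3.7).
* [GortzWedhorn2020] U. Görtz, T. Wedhorn, *Algebraic Geometry I*, 2nd ed. (2020), Definition 4.45 (2) (p. 117).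
-/

set_option autoImplicit false

-- Mathlib's `Over`/`Scheme` APIs are stated across semireducible wrappers (as in the ★ `GroupSchemes/*` files).
set_option backward.isDefEq.respectTransparency false

universe u

open CategoryTheory CategoryTheory.Limits AlgebraicGeometry MonoidalCategory CartesianMonoidalCategory

noncomputable section

namespace Literature.AlgebraicGeometry.GroupSchemes

namespace AffineGroupScheme

open scoped MonObj

open Literature.AlgebraicGeometry.Motives GroupSchemeKernel

/-! ## §1 Kernel points through an ambient monomorphism -/

section Ambient

variable {C : Type*} [Category C] [CartesianMonoidalCategory C] {G₁ G₂ A₁ A₂ : C} [GrpObj G₁] [GrpObj G₂] [GrpObj A₂]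
  (φ : G₁ ⟶ G₂) (ψ : A₁ ⟶ A₂) (ι₁ : G₁ ⟶ A₁) (ι₂ : G₂ ⟶ A₂) [IsMonHom ι₂] [Mono ι₂]

omit [GrpObj G₁] in
/-- A `T`-point of `G₁` is killed by `φ` iff it is killed by `φ ≫ ι₂` for a monomorphic hom `ι₂ : G₂ ↪ A₂`. [cite: GortzWedhorn2020, Definition 4.45 (2) (p. 117)] -/
theorem comp_eq_one_iff_comp_comp_eq_one_of_mono {T : C} (t : T ⟶ G₁) : t ≫ φ = 1 ↔ t ≫ φ ≫ ι₂ = 1 := by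
  constructor
  · intro h
    rw [← Category.assoc, h, MonObj.one_comp]
  · intro h
    rw [← cancel_mono ι₂, Category.assoc, h, MonObj.one_comp]

omit [GrpObj G₁] in
/-- **THE (ρ1) EXACTNESS CLAUSE IS THE KERNEL CLAUSE OF THE LAYER MAP**: if `φ` lies over `ψ` (`φ ≫ ι₂ = ι₁ ≫ ψ`) and the `T`-points `t` of `G₁` with
`t ≫ ι₁ ≫ ψ = 1` are exactly those factoring through `j : K ⟶ G₁`, then so are the `T`-points killed by `φ`. [cite: GortzWedhorn2020, Definition 4.45 (2) (p. 117)] -/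
theorem forall_comp_eq_one_iff_of_over (hover : φ ≫ ι₂ = ι₁ ≫ ψ) {K : C} (j : K ⟶ G₁)
    (hker : ∀ ⦃T : C⦄ (t : T ⟶ G₁), t ≫ ι₁ ≫ ψ = 1 ↔ ∃ s : T ⟶ K, s ≫ j = t) ⦃T : C⦄ (t : T ⟶ G₁) :
    t ≫ φ = 1 ↔ ∃ s : T ⟶ K, s ≫ j = t := by
  rw [comp_eq_one_iff_comp_comp_eq_one_of_mono φ ι₂, hover]
  exact hker t

end Ambient

/-! ## §2 `Ker φ ≅ V(H)` when they have the same points; the rank of `Γ(Ker φ)` -/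

section KernelIdeal

variable {k : Type u} [Field k] {G₁ G₂ : SchemeOver k} [GrpObj G₁] [GrpObj G₂] [IsAffine G₁.left] [IsAffine G₂.left] (φ : G₁ ⟶ G₂) [IsMonHom φ]
  (H : Ideal (Alg G₁))
  (hker : ∀ ⦃T : SchemeOver k⦄ (t : T ⟶ G₁), t ≫ φ = 1 ↔ ∃ s : T ⟶ Motives.specOver k (Alg G₁ ⧸ H), s ≫ quotIncl G₁ H = t)

omit [GrpObj G₁] [IsAffine G₂.left] [IsMonHom φ] in
include hker in
/-- **`Ker φ ≅ V(H)` OVER `G₁`** when the closed subscheme `V(H) = Spec (Γ(G₁) ⧸ H) ↪ G₁` has the `T`-points of `Ker φ` for every `T`: both are monomorphisms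
into `G₁` (★ `mono_kerι`, ★ `mono_quotIncl`) factoring through each other (★ `kerLift`, the hypothesis at `t := kerι φ`). [cite: GortzWedhorn2020, Definition 4.45 (2) (p. 117)] -/
theorem exists_iso_ker_specOver_quotient :
    ∃ e : ker φ ≅ Motives.specOver k (Alg G₁ ⧸ H), e.hom ≫ quotIncl G₁ H = kerι φ ∧ e.inv ≫ kerι φ = quotIncl G₁ H := by
  haveI := mono_kerι φ
  haveI := mono_quotIncl G₁ H
  obtain ⟨u, hu⟩ := (hker (kerι φ)).mp (kerι_comp φ)
  have hq : quotIncl G₁ H ≫ φ = 1 := (hker (quotIncl G₁ H)).mpr ⟨𝟙 _, Category.id_comp _⟩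
  exact exists_iso_of_fac_of_fac (kerι φ) (quotIncl G₁ H) u hu (kerLift (quotIncl G₁ H) hq) (kerLift_ι (quotIncl G₁ H) hq)

omit [GrpObj G₁] [IsAffine G₂.left] [IsMonHom φ] in
include hker in
/-- **`dim_k Γ(Ker φ) = dim_k (Γ(G₁) ⧸ H)`** (`Ker φ ≅ V(H)` + ★ `Alg.finrank_eq_of_iso` + ★ `algSpecOverEquiv : Γ(Spec (Γ(G₁) ⧸ H)) ≃ₐ Γ(G₁) ⧸ H`).
[cite: Milne2017, Ch. 11 §b Prop. 11.10] -/
theorem finrank_alg_ker_eq_finrank_quotient : Module.finrank k (Alg (ker φ)) = Module.finrank k (Alg G₁ ⧸ H) := by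
  obtain ⟨e, -, -⟩ := exists_iso_ker_specOver_quotient φ H hker
  rw [Alg.finrank_eq_of_iso e]
  exact (algSpecOverEquiv (R := k) (Alg G₁ ⧸ H)).toLinearEquiv.finrank_eq

end KernelIdeal

/-! ## §3 The image ideal: corank, uniqueness below the kernel, admissibility -/

section ImageIdeal

variable {k : Type u} [Field k] {G₁ G₂ : SchemeOver k} [GrpObj G₁] [GrpObj G₂] [IsAffine G₁.left] [IsAffine G₂.left] (φ : G₁ ⟶ G₂) [IsMonHom φ]
  [Module.Finite k (Alg G₁)] [Module.Finite k (Alg G₂)] {n m : ℕ} (H : Ideal (Alg G₁))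
  (hG₁ : Module.finrank k (Alg G₁) = n * m) (hH : Module.finrank k (Alg G₁ ⧸ H) = m)
  (hker : ∀ ⦃T : SchemeOver k⦄ (t : T ⟶ G₁), t ≫ φ = 1 ↔ ∃ s : T ⟶ Motives.specOver k (Alg G₁ ⧸ H), s ≫ quotIncl G₁ H = t)

omit [GrpObj G₁] [IsMonHom φ] [Module.Finite k (Alg G₁)] [Module.Finite k (Alg G₂)] in
include hker hH in
/-- The ideal `J(φ) = φ^*(Γ(G₂)⁺)·Γ(G₁)` of `Ker φ` has corank `m = dim_k (Γ(G₁) ⧸ H)` (★ `finrank_alg_ker_eq` + §2). [cite: Milne2017, Ch. 11 §b Prop. 11.10] -/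
theorem finrank_quotient_map_ker_counit_comap_eq_of_kernel_ideal :
    Module.finrank k (Alg G₁ ⧸ (RingHom.ker (Bialgebra.counitAlgHom k (Alg G₂))).map (Alg.comap φ)) = m :=
  ((finrank_alg_ker_eq φ).symm.trans (finrank_alg_ker_eq_finrank_quotient φ H hker)).trans hH

omit [Module.Finite k (Alg G₂)] in
include hG₁ hH hker in
/-- **CORANK OF THE IMAGE IDEAL**: `dim_k Γ(G₁) = n · m`, `V(H)` with the points of `Ker φ` and `dim_k (Γ(G₁) ⧸ H) = m` ⟹ `dim_k (Γ(G₂) ⧸ ker Γ(φ)) = n`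
(«order of the image = order of the source ⁄ order of the kernel», ★ (D6-rk) `finrank_quotient_ker_comap_eq_of_finrank_eq`). [cite: Milne2017, Ch. 11 §b Prop. 11.10] -/
theorem finrank_quotient_ker_appTop_eq_of_kernel_ideal :
    Module.finrank k (Alg G₂ ⧸ (RingHom.ker φ.left.appTop.hom : Ideal (Alg G₂))) = n := by
  rw [← ker_comap_eq_ker_appTop]
  exact finrank_quotient_ker_comap_eq_of_finrank_eq φ hG₁ (finrank_quotient_map_ker_counit_comap_eq_of_kernel_ideal φ H hH hker)

include hG₁ hH hker in
/-- **UNIQUENESS BELOW THE KERNEL — «THE IMAGE LINE»**: under the same hypotheses, an ideal `I ≤ ker Γ(φ)` of corank `n` IS `ker Γ(φ)` (★ (D6-rk) head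
`eq_ker_appTop_of_le_of_finrank_eq`).  This is the content of the D6 clause «every admissible `H′` below the kernel of the layer map is the image line».
[cite: Milne2017, Ch. 11 §b Prop. 11.10; Ch. 3 §b Prop. 3.15] -/
theorem eq_ker_appTop_of_le_of_kernel_ideal {I : Ideal (Alg G₂)} (hI : I ≤ (RingHom.ker φ.left.appTop.hom : Ideal (Alg G₂)))
    (hIn : Module.finrank k (Alg G₂ ⧸ I) = n) : I = (RingHom.ker φ.left.appTop.hom : Ideal (Alg G₂)) :=
  eq_ker_appTop_of_le_of_finrank_eq φ hI hG₁ (finrank_quotient_map_ker_counit_comap_eq_of_kernel_ideal φ H hH hker) hIn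

omit [GrpObj G₁] [GrpObj G₂] [IsAffine G₁.left] [IsAffine G₂.left] [IsMonHom φ] [Module.Finite k (Alg G₁)] [Module.Finite k (Alg G₂)] in
/-- **STABILITY OF THE IMAGE IDEAL**: if endomorphism families `β₁` of `G₁` and `β₂` of `G₂` are INTERTWINED by `φ` (`β₁ a ≫ φ = φ ≫ β₂ a`), then
`Γ(β₂ a)(ker Γ(φ)) ⊆ ker Γ(φ)` — for `x ∈ ker Γ(φ)`, `Γ(φ)(Γ(β₂ a) x) = Γ(β₂ a ∘ φ… ) = Γ(β₁ a)(Γ(φ) x) = 0` (★ `Alg.comap_comp`). [cite: Milne2017, Ch. 3 §b Prop. 3.15] -/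
theorem map_appTop_ker_appTop_le_of_comm {σ : Type*} (β₁ : σ → (G₁ ⟶ G₁)) (β₂ : σ → (G₂ ⟶ G₂)) (hβ : ∀ a, β₁ a ≫ φ = φ ≫ β₂ a) (a : σ) :
    (RingHom.ker φ.left.appTop.hom : Ideal (Alg G₂)).map (β₂ a).left.appTop.hom ≤ (RingHom.ker φ.left.appTop.hom : Ideal (Alg G₂)) := by
  rw [Ideal.map_le_iff_le_comap]
  intro x hx
  rw [Ideal.mem_comap, RingHom.mem_ker]
  rw [RingHom.mem_ker] at hx
  change Alg.comap φ (Alg.comap (β₂ a) x) = 0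
  change Alg.comap φ x = 0 at hx
  rw [← AlgHom.comp_apply, ← Alg.comap_comp, ← hβ a, Alg.comap_comp, AlgHom.comp_apply, hx, map_zero]

omit [Module.Finite k (Alg G₂)] in
include hG₁ hH hker in
/-- **THE IMAGE IDEAL IS ADMISSIBLE**: `ker Γ(φ)` is a Hopf ideal (★ `isHopfIdeal_ker_comap`, [Milne2017] Prop. 3.11), of corank `n`, and stable under every
`Γ(β₂ a)` for families intertwined by `φ` — the `IsAdm G₂ β₂ n` triple of the DICT constructors ∕ the right-hand side of ★ (UP-ADM) `exists_equiv_admissible`,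
unfolded. [cite: Milne2017, Ch. 3 §b Prop. 3.11; Ch. 11 §b Prop. 11.10] [cite: Tate1997FiniteFlatGroupSchemes, (3.7)] -/
theorem isHopfIdeal_and_finrank_and_map_le_ker_appTop {σ : Type*} (β₁ : σ → (G₁ ⟶ G₁)) (β₂ : σ → (G₂ ⟶ G₂))
    (hβ : ∀ a, β₁ a ≫ φ = φ ≫ β₂ a) :
    (RingHom.ker φ.left.appTop.hom : Ideal (Alg G₂)).IsHopfIdeal k ∧
      Module.finrank k (Alg G₂ ⧸ (RingHom.ker φ.left.appTop.hom : Ideal (Alg G₂))) = n ∧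
      ∀ a, (RingHom.ker φ.left.appTop.hom : Ideal (Alg G₂)).map (β₂ a).left.appTop.hom ≤ (RingHom.ker φ.left.appTop.hom : Ideal (Alg G₂)) :=
  ⟨(ker_comap_eq_ker_appTop φ) ▸ isHopfIdeal_ker_comap φ, finrank_quotient_ker_appTop_eq_of_kernel_ideal φ H hG₁ hH hker,
    map_appTop_ker_appTop_le_of_comm φ β₁ β₂ hβ⟩

include hG₁ hH hker in
/-- **D6-LETTER FORM — EVERY ADMISSIBLE IDEAL BELOW THE KERNEL IS THE IMAGE IDEAL**: for any endomorphism family `β₂` of `G₂`, an ideal `I` in the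
admissible subtype (Hopf, corank `n`, `β₂`-stable) with `I ≤ ker Γ(φ)` equals `ker Γ(φ)`.  (Only the corank is used.) [cite: Milne2017, Ch. 11 §b Prop. 11.10] -/
theorem eq_ker_appTop_of_admissible_of_le {σ : Type*} (β₂ : σ → (G₂ ⟶ G₂))
    (I : {I : Ideal (Alg G₂) // I.IsHopfIdeal k ∧ Module.finrank k (Alg G₂ ⧸ I) = n ∧ ∀ a, I.map (β₂ a).left.appTop.hom ≤ I})
    (hI : I.1 ≤ (RingHom.ker φ.left.appTop.hom : Ideal (Alg G₂))) : I.1 = (RingHom.ker φ.left.appTop.hom : Ideal (Alg G₂)) :=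
  eq_ker_appTop_of_le_of_kernel_ideal φ H hG₁ hH hker hI I.2.2.1

include hG₁ hH hker in
/-- **THE IMAGE LINE, `∃!` FORM**: for families `β₁`, `β₂` intertwined by `φ` there is EXACTLY ONE admissible ideal of `Γ(G₂)` (Hopf, corank `n`, `β₂`-stable)
below `ker Γ(φ)` — namely `ker Γ(φ)` itself.  (The `ImgAt` clause of the L2 letter [R] at the honest witness.) [cite: Milne2017, Ch. 11 §b Prop. 11.10]
[cite: Tate1997FiniteFlatGroupSchemes, (3.7)] -/
theorem existsUnique_admissible_le_ker_appTop {σ : Type*} (β₁ : σ → (G₁ ⟶ G₁)) (β₂ : σ → (G₂ ⟶ G₂)) (hβ : ∀ a, β₁ a ≫ φ = φ ≫ β₂ a) :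
    ∃! I : {I : Ideal (Alg G₂) // I.IsHopfIdeal k ∧ Module.finrank k (Alg G₂ ⧸ I) = n ∧ ∀ a, I.map (β₂ a).left.appTop.hom ≤ I},
      I.1 ≤ (RingHom.ker φ.left.appTop.hom : Ideal (Alg G₂)) :=
  ⟨⟨_, isHopfIdeal_and_finrank_and_map_le_ker_appTop φ H hG₁ hH hker β₁ β₂ hβ⟩, le_rfl, fun I hI =>
    Subtype.ext (eq_ker_appTop_of_admissible_of_le φ H hG₁ hH hker β₂ I hI)⟩

end ImageIdeal

/-! ## §4 The same, with the kernel clause stated through an ambient hom `ψ` (the (ρ1) shape) -/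

section Over

variable {k : Type u} [Field k] {G₁ G₂ A₁ A₂ : SchemeOver k} [GrpObj G₁] [GrpObj G₂] [GrpObj A₂] [IsAffine G₁.left] [IsAffine G₂.left]
  (φ : G₁ ⟶ G₂) [IsMonHom φ] (ψ : A₁ ⟶ A₂) (ι₁ : G₁ ⟶ A₁) (ι₂ : G₂ ⟶ A₂) [IsMonHom ι₂] [Mono ι₂] (hover : φ ≫ ι₂ = ι₁ ≫ ψ)
  [Module.Finite k (Alg G₁)] [Module.Finite k (Alg G₂)] {n m : ℕ} (H : Ideal (Alg G₁))
  (hG₁ : Module.finrank k (Alg G₁) = n * m) (hH : Module.finrank k (Alg G₁ ⧸ H) = m)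
  (hker : ∀ ⦃T : SchemeOver k⦄ (t : T ⟶ G₁), t ≫ ι₁ ≫ ψ = 1 ↔ ∃ s : T ⟶ Motives.specOver k (Alg G₁ ⧸ H), s ≫ quotIncl G₁ H = t)

omit [Module.Finite k (Alg G₂)] in
include hover hG₁ hH hker in
/-- **CORANK OF THE IMAGE IDEAL OF A LAYER MAP OVER `ψ`**: `φ ≫ ι₂ = ι₁ ≫ ψ`, `ψ` kills exactly `V(H) ↪ G₁ ↪ A₁` on `G₁`-points, `dim Γ(G₁) = n·m`,
`dim (Γ(G₁) ⧸ H) = m` ⟹ `dim (Γ(G₂) ⧸ ker Γ(φ)) = n`. [cite: Milne2017, Ch. 11 §b Prop. 11.10] -/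
theorem finrank_quotient_ker_appTop_eq_of_over :
    Module.finrank k (Alg G₂ ⧸ (RingHom.ker φ.left.appTop.hom : Ideal (Alg G₂))) = n :=
  finrank_quotient_ker_appTop_eq_of_kernel_ideal φ H hG₁ hH (forall_comp_eq_one_iff_of_over φ ψ ι₁ ι₂ hover (quotIncl G₁ H) hker)

include hover hG₁ hH hker in
/-- **D6-LETTER FORM OVER `ψ`**: every admissible ideal (Hopf, corank `n`, `β₂`-stable) below `ker Γ(φ)` IS `ker Γ(φ)`. [cite: Milne2017, Ch. 11 §b Prop. 11.10] -/
theorem eq_ker_appTop_of_admissible_of_le_of_over {σ : Type*} (β₂ : σ → (G₂ ⟶ G₂))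
    (I : {I : Ideal (Alg G₂) // I.IsHopfIdeal k ∧ Module.finrank k (Alg G₂ ⧸ I) = n ∧ ∀ a, I.map (β₂ a).left.appTop.hom ≤ I})
    (hI : I.1 ≤ (RingHom.ker φ.left.appTop.hom : Ideal (Alg G₂))) : I.1 = (RingHom.ker φ.left.appTop.hom : Ideal (Alg G₂)) :=
  eq_ker_appTop_of_admissible_of_le φ H hG₁ hH (forall_comp_eq_one_iff_of_over φ ψ ι₁ ι₂ hover (quotIncl G₁ H) hker) β₂ I hI

include hover hG₁ hH hker in
/-- **THE IMAGE LINE OVER `ψ`, `∃!` FORM**: for families `β₁`, `β₂` intertwined by `φ`, exactly one admissible ideal of `Γ(G₂)` lies below `ker Γ(φ)`.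
[cite: Milne2017, Ch. 11 §b Prop. 11.10] [cite: Tate1997FiniteFlatGroupSchemes, (3.7)] -/
theorem existsUnique_admissible_le_ker_appTop_of_over {σ : Type*} (β₁ : σ → (G₁ ⟶ G₁)) (β₂ : σ → (G₂ ⟶ G₂))
    (hβ : ∀ a, β₁ a ≫ φ = φ ≫ β₂ a) :
    ∃! I : {I : Ideal (Alg G₂) // I.IsHopfIdeal k ∧ Module.finrank k (Alg G₂ ⧸ I) = n ∧ ∀ a, I.map (β₂ a).left.appTop.hom ≤ I},
      I.1 ≤ (RingHom.ker φ.left.appTop.hom : Ideal (Alg G₂)) :=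
  existsUnique_admissible_le_ker_appTop φ H hG₁ hH (forall_comp_eq_one_iff_of_over φ ψ ι₁ ι₂ hover (quotIncl G₁ H) hker) β₁ β₂ hβ

end Over

end AffineGroupScheme

end Literature.AlgebraicGeometry.GroupSchemes

end
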